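import Literature.MathematicalPhysics.QuantumFieldTheory.Balaban1983to89.B16NodeKnitRepTower
import Literature.MathematicalPhysics.QuantumFieldTheory.Balaban1983to89.B14NodeKnitRepTowerLF

/-!
# `Balaban1983to89.B16NodeKnitRepTowerLF` — YM-DAG node N13 · [Balaban1989LargeFieldII] CMP **122** (1989) 355–392, Theorem 1 p. 355 + (0.1), Cor. 3
# pp. 387 ∕ 391: the represented-tower knit of N13 IN THE TREE'S OWN §2 CURRENCY (`Step.LFHyp ∕ LFHypImproved ∕ LFNewTerms`, seat dag-n11-a's
# `B14NodeKnitRepTowerLF`): N13's 𝐑-product = THE 𝐑-HALF of the tree's per-step obligation — «ReprT k ∧ NewT k ⟹ Repr (k+1) ∧ LFNewTerms T c βc k» —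
# and N13's Cor.-3 product = the pointwise (0.1) for every level that is «represented ∧ cumulative bounds ∧ improved newest bounds»; junction with N11's
# T-half BY NAME (N11's 𝐑-half DISCHARGED by N13's), up to the run's (B) and the tree's `Step.LFStepObligation`

statement-level bookkeeping over published theorems with citation tags; kernel-checked compositions of tree theorems;
nothing here is a claim about the Yang–Mills mass gap.

CITATION HEADER (lean-in-tree rule).  Source: T. Bałaban, *Large field renormalization. II. Localization, exponentiation, and bounds for the
𝐑 operation*, Commun. Math. Phys. **122**, 355–392 (1989), doi:10.1007/bf01238433 [Balaban1989LargeFieldII] (cell paper B16 = «[V]»), with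
[Balaban1988Convergent] («[III]»: (2.18) p. 257, the inductive hypotheses (2.19)–(2.42) pp. 258–262, Thm 1 p. 262, Cor. 3 (2.50) p. 264, the assumed 𝐑 p. 244,
p. 279) and [Balaban1989LargeFieldI] («[IV]»: (0.2)–(0.6) pp. 176–177, (1.80), (1.89)).  Seat `pub-ymgap-dag-n13-a` (YM-PLAN Track A, HUMAN RULING D-0062: the
KNIT-BY-NAME seat of node N13), module 10 of the seat.  BY NAME and UNCHANGED: `…B16NodeKnitRepTower` (module 8: the generic represented-tower knit),
`…B16NodeKnitSocket` (module 7: `uvSlot_of_direct`), `…B16NodeKnitRecord5` (module 5: `b16_main_of_rOperation_of_uvSlot`), `…B14NodeKnitRepTowerLF` (seat dag-n11-a: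
`b14_main_of_repTower_lf`, `b14_main_of_repTower_lf_eval`, `laws_succ_of_newTerms`, `lfStepObligation_of_halves`, `b14Thm1Shape_of_halves`), the pre-cell module
`…Step` (cell pub-balaban: `LFTower`, `LFConsts`, `LFHyp`, `LFHypImproved`, `LFNewTerms`, `LFSigns`, `LFStepObligation`, `B14Thm1Shape`), `…B16` (`UVIneq`),
`…Dag` (`B14_main` :224, `B16_main` :253, `UVStability4D` :261), `…DagBinding` (`leavesP`, `WorldP`).

WHY THIS FILE.  Module 8 knits N13 over NODE 00's Stage-₉ represented tower GENERICALLY (law families `Laws ∕ LawsT` as parameters).  Seat dag-n11-a's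
`B14NodeKnitRepTowerLF` (p413987) FIXES the law families to the tree's own §2 typing — `Laws k := Repr k ∧ Step.LFHyp T c k ∧ Step.LFHypImproved T c βc k` ([III] Thm 1:
«the form, and … all the conditions AND BOUNDS, described in Sect. 2»), the corresponding space `:= ReprT k ∧ NewT k` (p. 279: T's new terms 𝐄^{(k+1)}, 𝐑″^{(k+1)},
𝐁^{(k+1)} obey the PRE-𝐑 obligations) — and SEPARATES the tree's per-step obligation `Step.LFStepObligation` into the T-half (N11's own content, Theorem p. 245) and
the 𝐑-half `ReprT k → NewT k → Repr (k+1) ∧ LFNewTerms T c βc k` (p. 244's assumption).  That 𝐑-half IS what [Balaban1989LargeFieldII] proves for 𝐑 (Thm 1, pp.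
356–391: localisation and exponentiation of the new large-field terms, the bounds (1.80), (1.89) — the renormalised density has the (2.18) form with index k+1 and
its final new terms `𝐄^{(k+1)}, 𝐑^{(k+1)}, 𝐁^{(k+1)}` obey the inductive bounds; [III] p. 279: «Obviously in general new terms will be included into 𝐑^{(k+1)}»), and
Cor. 3 ([V] p. 387: «This implies the inequality (2.50) [III], hence Corollary 3») is the pointwise two-sided bound for every level carrying «represented ∧
cumulative bounds ∧ improved newest bounds».  This module states N13's two products in that currency and knits them with N11's T-half BY NAME.

WHAT THIS FILE PROVES (0 `sorry`, 0 `def`, standard axioms).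
§1 `uvSlot_of_lfBounds` (N13's Cor.-3 slot from (UV₉ᴸ): (0.1) pointwise for every level with `Repr k ∧ LFHyp T c k ∧ LFHypImproved T c βc k`, under the §2 reading
   `hSL`); `uvSlot_of_lfBounds_eval` (on the explicit `eval rep_k`); **`b16_main_of_repTower_lf`** (N13 at `(w, P)` from the 𝐑-HALF (R₉ᴸ) `hR9 : ∀ k < K, ReprT k → NewT k
   → Repr (k+1) ∧ LFNewTerms T c βc k`, its pin reading `hRpin`, and (UV₉ᴸ)); `b16_main_of_repTower_lf_eval`.  (With N13's 𝐑-half `hR9` as the `hR` of seat dag-n11-a's `lfStepObligation_of_halves` ∕ `b14Thm1Shape_of_halves`, the tree's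
   per-step obligation `Step.LFStepObligation` and Thm 1's shape `Step.B14Thm1Shape` need only N11's T-half — those two theorems BY NAME, not restated here.)
§2 Junction BY NAME: **`nodes_N11_N13_of_repTower_lf_eval`** (`Dag.B14_main ∧ Dag.B16_main` at `(w, P)` from the signs, (S0), N11's T-half (S1ᵀ), N13's 𝐑-half (R₉ᴸ) —
   which DISCHARGES N11's (𝐑) hypothesis —, the pin reading, (UV₉ᴸ), under the Stage-₉ reading of the densities); `uvStability4D_of_repTower_lf_eval` (the run's (B)).

HONEST FRAMING.  A count-neutral SLOT landing (R429 (4)(i)): N13 is NOT discharged — (R₉ᴸ) and (UV₉ᴸ) are displayed HYPOTHESES (what [Balaban1989LargeFieldII] proves);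
the term tower `T`, the constants `c, βc`, the representation predicates `Repr ∕ ReprT`, the pre-𝐑 obligations `NewT` and the evaluation are parameters NODE 00 Stage ₉
supplies; nothing of Bałaban's asserted or proved here; one finite four-torus programme at fixed `ε`, Bałaban AS PRINTED with locators; nothing continuum ∕ ℝ⁴ ∕ OS ∕
mass gap ∕ Clay.
-/

noncomputable section

namespace Literature.MathematicalPhysics.QuantumFieldTheory.Balaban1983to89.B16NodeKnitRepTowerLF

open DagBinding Step
open B16NodeKnitRecord5 (b16_main_of_rOperation_of_uvSlot)
open B16NodeKnitSocket (uvSlot_of_direct)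
open B14NodeKnitRepTowerLF (b14_main_of_repTower_lf_eval)

variable (w : WorldP) (P : B12.RunParams)
variable {G : Type*} [GaugeGroup G] {Φ 𝒢 𝔄 : Type*} {Pₛ : Params}
variable (T : LFTower Pₛ G Φ 𝒢 𝔄) (c : LFConsts) (βc : ℝ)

/-! ## §1. N13's two products in the tree's §2 currency -/

/-- **N13's Cor.-3 slot from (UV₉ᴸ)** ([Balaban1989LargeFieldII] (0.1) pp. 355–356, p. 387 *«This implies the inequality (2.50) [III], hence Corollary 3»*): if
`w.γ ≤ γ₁` and, under the interval hypothesis on `]0, γ₁]`, every level `k ≤ K` that is REPRESENTED with the CUMULATIVE bounds `Step.LFHyp T c k` and the IMPROVED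
newest-term bounds `Step.LFHypImproved T c βc k` ([III] (2.27)(i)(ii)(iv), (2.31), (2.42); p. 262) obeys the two-sided bound `B16.UVIneq (w.C P) k U (w.em g_k) (w.ep g_k)`
for every configuration `U`, and the run's §2-form clause at `k` yields that triple (`hSL`, the Stage-₉ reading in the tree's currency), then «(interval ⇒ §2
description) ⇒ (interval ⇒ `uvBounds`)» holds at `(w, P)`.  HYPOTHESIS; count-neutral. [cite: Balaban1989LargeFieldII, (0.1) pp.355–356, p.387; Balaban1988Convergent, Cor. 3 (2.50) p.264, (2.27)–(2.42) pp.259–262] -/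
theorem uvSlot_of_lfBounds (Repr : ℕ → Prop)
    (hSL : ∀ k, k ≤ P.K → (w.C P).Sect2Form k → Repr k ∧ LFHyp T c k ∧ LFHypImproved T c βc k) {γ₁ : ℝ} (hγ : w.γ ≤ γ₁)
    (hUV : (w.C P).flow.InInterval γ₁ P.K → ∀ k, k ≤ P.K → Repr k → LFHyp T c k → LFHypImproved T c βc k → ∀ U : (w.C P).Cfg k,
      B16.UVIneq (w.C P) k U (w.em ((w.C P).flow.g k)) (w.ep ((w.C P).flow.g k))) :
    ((leavesP w P).smallCouplings → (leavesP w P).densitiesDescribed) →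
      ((leavesP w P).smallCouplings → (leavesP w P).uvBounds) :=
  uvSlot_of_direct w P hγ fun hsc k hk hs U =>
    hUV hsc k hk (hSL k hk hs).1 (hSL k hk hs).2.1 (hSL k hk hs).2.2 U

variable {Rep : ℕ → Type*} (rep : (k : ℕ) → Rep k) (eval : (k : ℕ) → Rep k → ((w.C P).Cfg k → ℝ))

/-- **(UV₉ᴸ) on the explicit represented functions** (`ρ_k = eval rep_k`, `hρ`; the §2-form clause read as `ρ_k = eval rep_k ∧ (Repr k ∧ LFHyp k ∧ LFHypImproved k)`,
`hS9` — seat dag-n11-a's `b14_main_of_repTower_lf_eval` hypotheses verbatim): the bound stated ON `eval rep_k`, pointwise. [cite: Balaban1989LargeFieldII, (0.1) pp.355–356, p.387; Balaban1988Convergent, (2.18) p.257] -/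
theorem uvSlot_of_lfBounds_eval (Repr : ℕ → Prop) (hρ : ∀ k, (w.C P).ρ k = eval k (rep k))
    (hS9 : ∀ k, k ≤ P.K →
      ((w.C P).Sect2Form k ↔ ((w.C P).ρ k = eval k (rep k) ∧ (Repr k ∧ LFHyp T c k ∧ LFHypImproved T c βc k))))
    {γ₁ : ℝ} (hγ : w.γ ≤ γ₁)
    (hUV : (w.C P).flow.InInterval γ₁ P.K → ∀ k, k ≤ P.K → Repr k → LFHyp T c k → LFHypImproved T c βc k → ∀ U : (w.C P).Cfg k,
      (w.C P).χ k U * Real.exp (-(1 / ((w.C P).flow.g k) ^ 2 * (w.C P).wilsonBG k U) - w.em ((w.C P).flow.g k) * ((w.C P).numSites k : ℝ))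
          ≤ eval k (rep k) U ∧
        eval k (rep k) U ≤ Real.exp (w.ep ((w.C P).flow.g k) * ((w.C P).numSites k : ℝ))) :
    ((leavesP w P).smallCouplings → (leavesP w P).densitiesDescribed) →
      ((leavesP w P).smallCouplings → (leavesP w P).uvBounds) := by
  refine uvSlot_of_lfBounds w P T c βc Repr (fun k hk hs => ((hS9 k hk).1 hs).2) hγ fun hsc k hk hr h1 h2 U => ?_
  show _ ≤ (w.C P).ρ k U ∧ (w.C P).ρ k U ≤ _
  rw [hρ k]
  exact hUV hsc k hk hr h1 h2 U

/-- **N13 OVER A REPRESENTED TOWER IN THE TREE'S §2 CURRENCY** ([Balaban1989LargeFieldII] Thm 1 p. 355 + (0.1), Cor. 3 pp. 387 ∕ 391): `Dag.B16_main (leavesP w P)` from —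
(R₉ᴸ) `hR9`, THE 𝐑-HALF OF THE TREE'S PER-STEP OBLIGATION: for `k < K`, a T-represented density whose pre-𝐑 new terms obey `NewT k` is turned by 𝐑 into a
(2.18)-represented density with index `k+1` whose final new terms obey `Step.LFNewTerms T c βc k` (what [V] proves: localisation, exponentiation, (1.80), (1.89); [III]
p. 279 «new terms will be included into 𝐑^{(k+1)}»); the PIN READING `hRpin` of the world's 𝐑-leaf (NODE 00's Stage-₉ pin of the 𝐑-carriers along the tower, module 8
§2); the §2 reading `hSL`; and (UV₉ᴸ) `hUV` below the threshold `γ₁ ≥ w.γ`.  HYPOTHESES displayed; count-neutral.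
[cite: Balaban1989LargeFieldII, Thm 1 p.355, (0.1) pp.355–356, (1.80) p.383, (1.89) p.387, p.391; Balaban1988Convergent, p.244, p.279, Cor. 3 p.264] -/
theorem b16_main_of_repTower_lf (Repr ReprT NewT : ℕ → Prop)
    (hRpin : (∀ k, k < P.K → ReprT k → NewT k → Repr (k + 1) ∧ LFNewTerms T c βc k) → (w.up P).rOperation)
    (hR9 : ∀ k, k < P.K → ReprT k → NewT k → Repr (k + 1) ∧ LFNewTerms T c βc k)
    (hSL : ∀ k, k ≤ P.K → (w.C P).Sect2Form k → Repr k ∧ LFHyp T c k ∧ LFHypImproved T c βc k) {γ₁ : ℝ} (hγ : w.γ ≤ γ₁)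
    (hUV : (w.C P).flow.InInterval γ₁ P.K → ∀ k, k ≤ P.K → Repr k → LFHyp T c k → LFHypImproved T c βc k → ∀ U : (w.C P).Cfg k,
      B16.UVIneq (w.C P) k U (w.em ((w.C P).flow.g k)) (w.ep ((w.C P).flow.g k))) :
    Dag.B16_main (leavesP w P) :=
  b16_main_of_rOperation_of_uvSlot w P (hRpin hR9) (uvSlot_of_lfBounds w P T c βc Repr hSL hγ hUV)

/-- **N13 in the tree's §2 currency UNDER THE STAGE-₉ READING OF THE DENSITIES** (`hρ`, `hS9` shared verbatim with seat dag-n11-a's `b14_main_of_repTower_lf_eval`), (UV₉ᴸ)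
on the explicit `eval rep_k`. [cite: Balaban1989LargeFieldII, Thm 1 p.355, (0.1) pp.355–356, p.387, p.391; Balaban1988Convergent, (2.18) p.257, p.244] -/
theorem b16_main_of_repTower_lf_eval (Repr ReprT NewT : ℕ → Prop) (hρ : ∀ k, (w.C P).ρ k = eval k (rep k))
    (hS9 : ∀ k, k ≤ P.K →
      ((w.C P).Sect2Form k ↔ ((w.C P).ρ k = eval k (rep k) ∧ (Repr k ∧ LFHyp T c k ∧ LFHypImproved T c βc k))))
    (hRpin : (∀ k, k < P.K → ReprT k → NewT k → Repr (k + 1) ∧ LFNewTerms T c βc k) → (w.up P).rOperation)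
    (hR9 : ∀ k, k < P.K → ReprT k → NewT k → Repr (k + 1) ∧ LFNewTerms T c βc k) {γ₁ : ℝ} (hγ : w.γ ≤ γ₁)
    (hUV : (w.C P).flow.InInterval γ₁ P.K → ∀ k, k ≤ P.K → Repr k → LFHyp T c k → LFHypImproved T c βc k → ∀ U : (w.C P).Cfg k,
      (w.C P).χ k U * Real.exp (-(1 / ((w.C P).flow.g k) ^ 2 * (w.C P).wilsonBG k U) - w.em ((w.C P).flow.g k) * ((w.C P).numSites k : ℝ))
          ≤ eval k (rep k) U ∧
        eval k (rep k) U ≤ Real.exp (w.ep ((w.C P).flow.g k) * ((w.C P).numSites k : ℝ))) :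
    Dag.B16_main (leavesP w P) :=
  b16_main_of_rOperation_of_uvSlot w P (hRpin hR9) (uvSlot_of_lfBounds_eval w P T c βc rep eval Repr hρ hS9 hγ hUV)

/-! ## §2. Junction with N11's T-half BY NAME -/

/-- **N11 ∧ N13 ON ONE REPRESENTED TOWER IN THE TREE'S §2 CURRENCY, BY NAME** (seat dag-n11-a's `b14_main_of_repTower_lf_eval` + `b16_main_of_repTower_lf_eval`): under
the Stage-₉ reading of the densities (`hρ`, `hS9`), from the signs under the interval hypothesis (`hsg`), (S0) the Wilson start is represented, (S1ᵀ) THE THEOREM OF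
[Balaban1988Convergent] p. 245 (N11's T-half, pre-𝐑 obligations `NewT`, given N11's antecedents), (R₉ᴸ) N13's 𝐑-half — which DISCHARGES N11's (𝐑) hypothesis
outright —, the pin reading of the world's 𝐑-leaf, and (UV₉ᴸ) on `eval rep_k`. [cite: Balaban1988Convergent, Thm 1 p.262, Theorem p.245, p.279, p.244; Balaban1989LargeFieldII, Thm 1 p.355, (0.1) pp.355–356, p.387, p.391] -/
theorem nodes_N11_N13_of_repTower_lf_eval (Repr ReprT NewT : ℕ → Prop) (hρ : ∀ k, (w.C P).ρ k = eval k (rep k))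
    (hS9 : ∀ k, k ≤ P.K →
      ((w.C P).Sect2Form k ↔ ((w.C P).ρ k = eval k (rep k) ∧ (Repr k ∧ LFHyp T c k ∧ LFHypImproved T c βc k))))
    (hsg : (leavesP w P).smallCouplings → LFSigns T c βc P.K)
    (h0 : (leavesP w P).smallCouplings → Repr 0)
    (hT : (leavesP w P).b7 → (leavesP w P).b8 → (leavesP w P).b9 → (leavesP w P).b10 → (leavesP w P).b11 →
      (leavesP w P).smallCouplings → (leavesP w P).smallFieldInductive → (leavesP w P).flowControl →
        ∀ k, k < P.K → Repr k → LFHyp T c k → LFHypImproved T c βc k → ReprT k ∧ NewT k)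
    (hRpin : (∀ k, k < P.K → ReprT k → NewT k → Repr (k + 1) ∧ LFNewTerms T c βc k) → (w.up P).rOperation)
    (hR9 : ∀ k, k < P.K → ReprT k → NewT k → Repr (k + 1) ∧ LFNewTerms T c βc k) {γ₁ : ℝ} (hγ : w.γ ≤ γ₁)
    (hUV : (w.C P).flow.InInterval γ₁ P.K → ∀ k, k ≤ P.K → Repr k → LFHyp T c k → LFHypImproved T c βc k → ∀ U : (w.C P).Cfg k,
      (w.C P).χ k U * Real.exp (-(1 / ((w.C P).flow.g k) ^ 2 * (w.C P).wilsonBG k U) - w.em ((w.C P).flow.g k) * ((w.C P).numSites k : ℝ))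
          ≤ eval k (rep k) U ∧
        eval k (rep k) U ≤ Real.exp (w.ep ((w.C P).flow.g k) * ((w.C P).numSites k : ℝ))) :
    Dag.B14_main (leavesP w P) ∧ Dag.B16_main (leavesP w P) :=
  ⟨b14_main_of_repTower_lf_eval w P T c βc rep eval Repr ReprT NewT hρ hS9 hsg h0 hT fun _ => hR9,
    b16_main_of_repTower_lf_eval w P T c βc rep eval Repr ReprT NewT hρ hS9 hRpin hR9 hγ hUV⟩

/-- **The run's (B) `Dag.UVStability4D (leavesP w P)` in the tree's §2 currency**: the slots of `nodes_N11_N13_of_repTower_lf_eval`, GIVEN — as hypotheses — N11's in-edge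
leaves `b7 … b11`, N13's `b5, b6, b13, rBasicStep`, the small-field leaf and the flow step.  Pure composition. [cite: Balaban1989LargeFieldII, Thm 1 + (0.1) p.355; Balaban1988Convergent, Thm 1 p.262] -/
theorem uvStability4D_of_repTower_lf_eval (Repr ReprT NewT : ℕ → Prop) (hρ : ∀ k, (w.C P).ρ k = eval k (rep k))
    (hS9 : ∀ k, k ≤ P.K →
      ((w.C P).Sect2Form k ↔ ((w.C P).ρ k = eval k (rep k) ∧ (Repr k ∧ LFHyp T c k ∧ LFHypImproved T c βc k))))
    (hsg : (leavesP w P).smallCouplings → LFSigns T c βc P.K)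
    (h0 : (leavesP w P).smallCouplings → Repr 0)
    (hT : (leavesP w P).b7 → (leavesP w P).b8 → (leavesP w P).b9 → (leavesP w P).b10 → (leavesP w P).b11 →
      (leavesP w P).smallCouplings → (leavesP w P).smallFieldInductive → (leavesP w P).flowControl →
        ∀ k, k < P.K → Repr k → LFHyp T c k → LFHypImproved T c βc k → ReprT k ∧ NewT k)
    (hRpin : (∀ k, k < P.K → ReprT k → NewT k → Repr (k + 1) ∧ LFNewTerms T c βc k) → (w.up P).rOperation)
    (hR9 : ∀ k, k < P.K → ReprT k → NewT k → Repr (k + 1) ∧ LFNewTerms T c βc k) {γ₁ : ℝ} (hγ : w.γ ≤ γ₁)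
    (hUV : (w.C P).flow.InInterval γ₁ P.K → ∀ k, k ≤ P.K → Repr k → LFHyp T c k → LFHypImproved T c βc k → ∀ U : (w.C P).Cfg k,
      (w.C P).χ k U * Real.exp (-(1 / ((w.C P).flow.g k) ^ 2 * (w.C P).wilsonBG k U) - w.em ((w.C P).flow.g k) * ((w.C P).numSites k : ℝ))
          ≤ eval k (rep k) U ∧
        eval k (rep k) U ≤ Real.exp (w.ep ((w.C P).flow.g k) * ((w.C P).numSites k : ℝ)))
    (h5 : (leavesP w P).b5) (h6 : (leavesP w P).b6) (h7 : (leavesP w P).b7) (h8 : (leavesP w P).b8) (h9 : (leavesP w P).b9)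
    (h10 : (leavesP w P).b10) (h11 : (leavesP w P).b11) (h13 : (leavesP w P).b13) (hrb : (leavesP w P).rBasicStep)
    (hsf : (leavesP w P).smallCouplings → (leavesP w P).smallFieldInductive)
    (hfc : (leavesP w P).smallCouplings → (leavesP w P).flowControl) :
    Dag.UVStability4D (leavesP w P) := by
  obtain ⟨h14, h16⟩ := nodes_N11_N13_of_repTower_lf_eval w P T c βc rep eval Repr ReprT NewT hρ hS9 hsg h0 hT hRpin hR9 hγ hUV
  obtain ⟨hrop, huv⟩ := h16 h5 h6 h7 h9 h10 h11 h13 hrb hsf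
  have hdd : (leavesP w P).smallCouplings → (leavesP w P).densitiesDescribed := h14 h7 h8 h9 h10 h11 hsf hfc hrop
  exact fun hsc => ⟨hdd hsc, huv hdd hsc⟩

end Literature.MathematicalPhysics.QuantumFieldTheory.Balaban1983to89.B16NodeKnitRepTowerLF

end
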